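import Summits.QuantumFields.BalabanUV.T4Continuum.Support.NE7AdmissibleFibreLHC
import Summits.QuantumFields.BalabanUV.T4Continuum.Support.AveragingDeficitChartCalculus
import Mathlib.Analysis.Calculus.InverseFunctionTheorem.FDeriv
import Mathlib.Analysis.Calculus.ContDiff.RCLike
import HarnessLib

/-!
# NE7AdmissibleFibreQuantitative — THE ADMISSIBLE FIBRES ARE LOWER HEMICONTINUOUS AT INTERIOR POINTS WITH A LINEAR RATE: gen 68's `NE7AdmissibleFibreLHC.admissible_lhc`
# (qualitative: every datum near `Q̄_{k+1}(U₀)` is the average of SOME class configuration near `U₀`) made QUANTITATIVE — the competitor lies in the torus chart at `U₀` at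
# chart distance `≤ κ⁻¹·‖y(D)‖` and its window Wilson action differs from that of `U₀` by `≤ C·‖y(D)‖`, where `y(D) = skewPR (relLog D₀ D)` is the `𝔲(n)` chart coordinate
# of the datum `D` relative to `D₀ = Q̄_{k+1}(U₀)` (Mathlib's quantitative open-mapping half of the inverse function theorem,
# `ApproximatesLinearOn.surjOn_closedBall_of_nonlinearRightInverse`, on row NE3-R2's submersion `hasStrictFDerivAt_levelQ` ∕ `levelQ'_onto`; the action is `C¹` in the
# chart, `AveragingDeficitChartCalculus.contDiffAt_fineAction_chart`, hence locally Lipschitz) — the brick any Hölder∕Lipschitz dependence of `U_k(V)` on `V` starts from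

Cell `pub-balaban`, rung (B)+1 sub-cell t4, lineage `b2b-balaban-t4-ne7-p1` (CRUX PROVER NE7 #1 = OWNER of BINDER row NE7), generation 113.  Memo
`t4/b2b-balaban-t4-ne7-p1-g113/ROAD-G113.md` §6 next (i).  The proof is gen 68's (F25 §5) with `map g (𝓝 0) = 𝓝 0` replaced by the linear-rate surjectivity on balls and
the action's local Lipschitz bound added; the decoding (`eq_of_skewPR_relLog_eq`) and the class-radius step (`eventually_smallField_chart`, INTERIORITY) are verbatim.
WHAT ([folklore]; 0 def, 0 sorry; generic `d`, every `U(n)`, `L ≥ 1`).  **`admissible_lhc_quantitative`**: `LevelSmall d L k (ε(L^{k+1})^{−2})`, `U₀ ∈ admissible (sfClass d L N ε) L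
(k+1) D₀`, `SmallField U₀ a`, `a < ε(L^{k+1})^{−2}`, `W` any finite window ⟹ `∃ κ > 0, ∃ C ≥ 0, ∀ᶠ D in 𝓝 D₀, D unitary ∧ N-periodic → ∃ Φ ∈ skewSub (L·tower L N k)` with
`‖Φ‖ ≤ ‖y(D)‖∕κ`, `chart_id U₀ Φ ∈ admissible (sfClass d L N ε) L (k+1) D` and `|fineAction (chart_id U₀ Φ) W − fineAction U₀ W| ≤ C·‖y(D)‖`.
HONEST FRAMING (page 1): soft finite-dimensional calculus (Banach open mapping with a nonlinear right inverse; `κ`, `C` EXISTENTIAL and NOT uniform in `U₀`, `k`, `N`) +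
kinematics; nothing is asserted about Bałaban's minimisers; NOT NE7, NOT NE3; spine 0∕9; finite T⁴ rung (B)+1 — NOT infinite volume, NOT mass gap, NOT BetaPertH, NOT Clay
(continuum YM on T⁴ ⇐ BetaPertH ∧ nine spine estimates).
-/

set_option autoImplicit false

open scoped BigOperators Matrix Matrix.Norms.L2Operator Topology NNReal
open NormedSpace Finset Set Filter Metric

namespace Summit.QuantumFields.BalabanUV.T4Continuum.NE7AdmissibleFibreQuantitative

open Literature.MathematicalPhysics.QuantumFieldTheory.Balaban1983to89
open B7Prop1Explicit B7Prop2Explicit MatrixLog UnitaryModel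
open T4AveragingDeficitWall (IsUnitaryCfg IsSkewDir SmallField vary fineAction)
open T4AveragingDeficitWallBoundary (IsPeriodicCfg periodBox)
open AveragingDeficitPeriodicCounting (IsPeriodicDir)
open AveragingDeficitTorusChart (TDir redN chart chartDir chart_zero skewP skewP_of_mem skewP_mem isUnitaryCfg_chart isPeriodicCfg_chart)
open AveragingDeficitChartCalculus (cavg relLog relLog_self mlog_one contDiffAt_fineAction_chart)
open AveragingDeficitFermat (eventually_smallField_chart)
open AveragingDeficitTwoLevelPrep (skewSub mem_skewSub skewPF skewPR skewPF_of_mem skewPF_apply)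
open AveragingDeficitMultiLevelPrep (tower cavgIter levelQ levelQ' levelQ_self LevelSmall cavgIter_unitary_small isPeriodicCfg_cavgIter
  natCast_tower_succ tower_ne_zero)
open AveragingDeficitMultiLevelFermat (hasStrictFDerivAt_levelQ levelQ'_onto continuousAt_cavgIter_chart)
open AveragingDeficitMultiLevelBridge (cavgIter_eq_avgIter tower_eq)
open MinimalActionSandwich (admissible)
open MinimalActionRate (sfClass)
open NE7AdmissibleFibreLHC (continuous_chart chart_id_eq_chart_skewP eq_of_skewPR_relLog_eq tendsto_skewPR_relLog eventually_near_base period_succ_eq)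

noncomputable section

variable {d : ℕ} {n : Type*} [Fintype n] [DecidableEq n]

/-- **QUANTITATIVE LOWER HEMICONTINUITY OF THE ADMISSIBLE FIBRES AT AN INTERIOR CONFIGURATION** (statement in the file header): near `D₀ = Q̄_{k+1}(U₀)`, every unitary
`N`-periodic datum `D` carries an admissible class configuration in the torus chart at `U₀` at chart distance `≤ ‖y(D)‖∕κ` from `U₀` and with window action within `C·‖y(D)‖`
of that of `U₀`. [folklore] -/
theorem admissible_lhc_quantitative [Nonempty n] {L N k : ℕ} [NeZero L] [NeZero N] (hL : 1 ≤ L) {ε a : ℝ} (hε : 0 ≤ ε)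
    (hls : LevelSmall d L k (ε / ((L : ℝ) ^ (k + 1)) ^ 2)) {D₀ U₀ : Site d → Fin d → (Matrix n n ℂ)ˣ}
    (hU₀ : U₀ ∈ admissible (sfClass d L N ε) L (k + 1) D₀) (haε : a < ε / ((L : ℝ) ^ (k + 1)) ^ 2) (hU₀a : SmallField U₀ a)
    (W : Finset (T4AveragingDeficitWall.Plaq d)) :
    ∃ κ C : ℝ, 0 < κ ∧ 0 ≤ C ∧ ∀ᶠ D in 𝓝 D₀, IsUnitaryCfg D → IsPeriodicCfg D (N : ℤ) →
      ∃ Φ : ↥(skewSub d n (L * tower L N k)),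
        ‖Φ‖ ≤ ‖skewPR N (relLog N D₀ D)‖ / κ ∧
        chart (ContinuousLinearMap.id ℝ (Matrix n n ℂ)) (L * tower L N k) U₀ (Φ : TDir d n (L * tower L N k)) ∈ admissible (sfClass d L N ε) L (k + 1) D ∧
        |fineAction (chart (ContinuousLinearMap.id ℝ (Matrix n n ℂ)) (L * tower L N k) U₀ (Φ : TDir d n (L * tower L N k))) W - fineAction U₀ W|
          ≤ C * ‖skewPR N (relLog N D₀ D)‖ := by
  set M : ℕ := L * tower L N k with hMdef
  set x : ℝ := ε / ((L : ℝ) ^ (k + 1)) ^ 2 with hxdef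
  have hx : 0 ≤ x := by rw [hxdef]; positivity
  obtain ⟨⟨hU₀u, hU₀P, hU₀x⟩, hU₀avg⟩ := hU₀
  have eP : ((N * L ^ (k + 1) : ℕ) : ℤ) = (L : ℤ) * (tower L N k : ℕ) := by rw [tower_eq]; push_cast; ring
  have ePM : ((N * L ^ (k + 1) : ℕ) : ℤ) = (M : ℤ) := by rw [hMdef]; push_cast; rw [tower_eq]; push_cast; ring
  have hU₀P' : IsPeriodicCfg U₀ ((L : ℤ) * (tower L N k : ℕ)) := by rw [← eP]; exact hU₀P
  have hU₀PM : IsPeriodicCfg U₀ (M : ℤ) := by rw [← ePM]; exact hU₀P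
  have hcD : cavgIter L (k + 1) U₀ = D₀ := by rw [cavgIter_eq_avgIter]; exact hU₀avg
  have hD₀u : IsUnitaryCfg D₀ := by
    obtain ⟨h, -, -⟩ := cavgIter_unitary_small hL k hU₀u hx hls hU₀x
    rwa [hcD] at h
  haveI : CompleteSpace ↥(skewSub d n M) := FiniteDimensional.complete ℝ _
  haveI : CompleteSpace ↥(skewSub d n N) := FiniteDimensional.complete ℝ _
  -- the constraint map in the chart and its strict derivative (row NE3-R2), onto
  set g : ↥(skewSub d n M) → ↥(skewSub d n N) := fun Φ =>
    levelQ L N k U₀ (chart (ContinuousLinearMap.id ℝ (Matrix n n ℂ)) M U₀ (Φ : TDir d n M)) with hg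
  have hQ := hasStrictFDerivAt_levelQ (d := d) (n := n) (M' := N) hL k hU₀u hU₀P' hx hls hU₀x
  have hι := ((skewSub d n M).subtypeL).hasStrictFDerivAt (x := 0)
  have hcomp : HasStrictFDerivAt g ((levelQ' L N k U₀).comp (skewSub d n M).subtypeL) 0 := by
    have h := HasStrictFDerivAt.comp (0 : ↥(skewSub d n M)) (by simpa using hQ) hι
    exact h
  have hrange : ((levelQ' L N k U₀).comp (skewSub d n M).subtypeL).range = ⊤ := by
    refine LinearMap.range_eq_top.mpr fun γ => ?_
    obtain ⟨Φ, hΦs, hΦ⟩ := levelQ'_onto (d := d) (n := n) (M' := N) hL k hU₀u hU₀P' hx hls hU₀x γ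
    exact ⟨⟨Φ, mem_skewSub.mpr hΦs⟩, by simpa using hΦ⟩
  have hg0 : g 0 = 0 := by
    simp only [hg, Submodule.coe_zero, chart_zero, levelQ_self]
  -- Mathlib's quantitative open mapping: a nonlinear right inverse and the approximation on a neighbourhood
  set f'symm := ((levelQ' L N k U₀).comp (skewSub d n M).subtypeL).nonlinearRightInverseOfSurjective hrange with hf'symm
  have hnn : 0 < f'symm.nnnorm := ContinuousLinearMap.nonlinearRightInverseOfSurjective_nnnorm_pos _ hrange
  set c : ℝ≥0 := f'symm.nnnorm⁻¹ / 2 with hc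
  have cpos : 0 < c := by simp [hc, inv_pos, hnn]
  obtain ⟨s, hs, happ⟩ := hcomp.approximates_deriv_on_nhds (Or.inr cpos)
  have hκ : (0 : ℝ) < (f'symm.nnnorm : ℝ)⁻¹ - c := by
    have h1 : ((f'symm.nnnorm : ℝ)⁻¹ - c : ℝ) = (c : ℝ) := by
      simp only [hc, NNReal.coe_div, NNReal.coe_inv, NNReal.coe_ofNat]; ring
    rw [h1]; exact_mod_cast cpos
  set κ : ℝ := (f'symm.nnnorm : ℝ)⁻¹ - c with hκdef
  -- the action is C¹, hence Lipschitz near `0`, along the chart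
  set ch : ↥(skewSub d n M) → (Site d → Fin d → (Matrix n n ℂ)ˣ) := fun Φ =>
    chart (ContinuousLinearMap.id ℝ (Matrix n n ℂ)) M U₀ (Φ : TDir d n M) with hch
  have hA : ContDiffAt ℝ 1 (fun Φ : ↥(skewSub d n M) => fineAction (ch Φ) W) 0 :=
    (contDiffAt_fineAction_chart (m := 1) (ContinuousLinearMap.id ℝ (Matrix n n ℂ)) M U₀ W _).comp (0 : ↥(skewSub d n M))
      (skewSub d n M).subtypeL.contDiff.contDiffAt
  obtain ⟨K, t, ht, hLip⟩ := hA.exists_lipschitzOnWith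
  have hch0 : ch 0 = U₀ := by simp only [hch, Submodule.coe_zero, chart_zero]
  -- the good chart parameters (verbatim F25): class radius and decoding margin
  have hval0 : Tendsto (fun Φ : ↥(skewSub d n M) => (Φ : TDir d n M)) (𝓝 0) (𝓝 0) := by
    have h := continuous_subtype_val.tendsto (0 : ↥(skewSub d n M))
    rwa [Submodule.coe_zero] at h
  have hV2 : ∀ᶠ Φ : ↥(skewSub d n M) in 𝓝 0, SmallField (ch Φ) x :=
    hval0.eventually (eventually_smallField_chart (ContinuousLinearMap.id ℝ (Matrix n n ℂ)) M hU₀PM haε hU₀a)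
  have hV3' : ∀ᶠ θ : TDir d n M in 𝓝 0, ∀ (r : Fin d → Fin N) (κ' : Fin d),
      ‖(((D₀ (boxVec N r) κ')⁻¹ : (Matrix n n ℂ)ˣ) : Matrix n n ℂ)
        * (cavgIter L (k + 1) (chart (ContinuousLinearMap.id ℝ (Matrix n n ℂ)) M U₀ θ) (boxVec N r) κ' : Matrix n n ℂ) - 1‖ ≤ 1 / 4 := by
    refine Filter.eventually_all.mpr fun r => Filter.eventually_all.mpr fun κ' => ?_
    have hc0 := continuousAt_cavgIter_chart (d := d) (n := n) hL N k (ContinuousLinearMap.id ℝ (Matrix n n ℂ)) hU₀u hU₀P' hx hls hU₀x (boxVec N r) κ'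
    have hcn : ContinuousAt (fun θ : TDir d n M =>
        ‖(((D₀ (boxVec N r) κ')⁻¹ : (Matrix n n ℂ)ˣ) : Matrix n n ℂ)
          * ((cavgIter L (k + 1) (chart (ContinuousLinearMap.id ℝ (Matrix n n ℂ)) M U₀ θ) (boxVec N r) κ' : (Matrix n n ℂ)ˣ) : Matrix n n ℂ) - 1‖) 0 :=
      ((continuousAt_const.mul hc0).sub continuousAt_const).norm
    have h0 : ‖(((D₀ (boxVec N r) κ')⁻¹ : (Matrix n n ℂ)ˣ) : Matrix n n ℂ)
        * ((cavgIter L (k + 1) (chart (ContinuousLinearMap.id ℝ (Matrix n n ℂ)) M U₀ 0) (boxVec N r) κ' : (Matrix n n ℂ)ˣ) : Matrix n n ℂ) - 1‖ < 1 / 4 := by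
      rw [chart_zero, hcD, Units.inv_mul, sub_self, norm_zero]
      norm_num
    exact (hcn.eventually (gt_mem_nhds h0)).mono fun θ hθ => hθ.le
  have hV3 : ∀ᶠ Φ : ↥(skewSub d n M) in 𝓝 0, ∀ (r : Fin d → Fin N) (κ' : Fin d),
      ‖(((D₀ (boxVec N r) κ')⁻¹ : (Matrix n n ℂ)ˣ) : Matrix n n ℂ) * (cavgIter L (k + 1) (ch Φ) (boxVec N r) κ' : Matrix n n ℂ) - 1‖ ≤ 1 / 4 :=
    hval0.eventually hV3'
  -- a closed ball of chart parameters inside all the good sets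
  obtain ⟨ρ₀, hρ₀, hball⟩ : ∃ ρ₀ > 0, closedBall (0 : ↥(skewSub d n M)) ρ₀ ⊆ s ∩ t ∩ {Φ | SmallField (ch Φ) x ∧ ∀ (r : Fin d → Fin N) (κ' : Fin d),
      ‖(((D₀ (boxVec N r) κ')⁻¹ : (Matrix n n ℂ)ˣ) : Matrix n n ℂ) * (cavgIter L (k + 1) (ch Φ) (boxVec N r) κ' : Matrix n n ℂ) - 1‖ ≤ 1 / 4} := by
    have hmem : s ∩ t ∩ {Φ | SmallField (ch Φ) x ∧ ∀ (r : Fin d → Fin N) (κ' : Fin d),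
        ‖(((D₀ (boxVec N r) κ')⁻¹ : (Matrix n n ℂ)ˣ) : Matrix n n ℂ) * (cavgIter L (k + 1) (ch Φ) (boxVec N r) κ' : Matrix n n ℂ) - 1‖ ≤ 1 / 4}
        ∈ 𝓝 (0 : ↥(skewSub d n M)) := inter_mem (inter_mem hs ht) (hV2.and hV3)
    obtain ⟨r, hr, hrsub⟩ := Metric.mem_nhds_iff.mp hmem
    exact ⟨r / 2, by positivity, (closedBall_subset_ball (by linarith)).trans hrsub⟩
  refine ⟨κ, K / κ, hκ, by positivity, ?_⟩
  -- the datum: coordinate small, bondwise near the base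
  have hcoord : ∀ᶠ D in 𝓝 D₀, ‖skewPR N (relLog N D₀ D)‖ < κ * ρ₀ := by
    have h := tendsto_skewPR_relLog (d := d) (n := n) N D₀
    have hb : ball (0 : ↥(skewSub d n N)) (κ * ρ₀) ∈ 𝓝 (0 : ↥(skewSub d n N)) := ball_mem_nhds _ (by positivity)
    have h2 : ∀ᶠ D in 𝓝 D₀, skewPR N (relLog N D₀ D) ∈ ball (0 : ↥(skewSub d n N)) (κ * ρ₀) := h hb
    exact h2.mono fun D hD => by simpa [dist_zero_right] using hD
  have hnear := eventually_near_base (d := d) (n := n) N D₀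
  filter_upwards [hcoord, hnear] with D hD hDnear hDu hDP
  set y : ↥(skewSub d n N) := skewPR N (relLog N D₀ D) with hy
  -- the radius and the surjectivity on the closed ball
  set ρ : ℝ := ‖y‖ / κ with hρ
  have hρ0 : 0 ≤ ρ := by positivity
  have hρle : ρ ≤ ρ₀ := by
    rw [hρ, div_le_iff₀ hκ]; linarith [mul_comm κ ρ₀]
  have hsub : closedBall (0 : ↥(skewSub d n M)) ρ ⊆ s := fun Φ hΦ => (hball (closedBall_subset_closedBall hρle hΦ)).1.1
  have hsurj := happ.surjOn_closedBall_of_nonlinearRightInverse f'symm hρ0 hsub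
  have hyball : y ∈ closedBall (g 0) (((f'symm.nnnorm : ℝ)⁻¹ - c) * ρ) := by
    rw [hg0, mem_closedBall, dist_zero_right]
    show ‖y‖ ≤ κ * ρ
    rw [hρ, mul_div_cancel₀ _ hκ.ne']
  obtain ⟨Φ, hΦball, hgΦ⟩ := hsurj hyball
  have hΦρ : ‖Φ‖ ≤ ρ := by simpa [dist_zero_right] using hΦball
  have hΦgood := hball (closedBall_subset_closedBall hρle hΦball)
  obtain ⟨⟨-, hΦt⟩, hΦx, hΦnear⟩ := hΦgood
  have h0t : (0 : ↥(skewSub d n M)) ∈ t := (hball (mem_closedBall_self hρ₀.le)).1.2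
  refine ⟨Φ, hΦρ, ?_, ?_⟩
  · -- admissibility: class membership and decoding of the top average (verbatim F25)
    have hΦs : (Φ : TDir d n M) ∈ skewSub d n M := Φ.2
    have hchu : IsUnitaryCfg (ch Φ) := by
      show IsUnitaryCfg (chart (ContinuousLinearMap.id ℝ (Matrix n n ℂ)) M U₀ (Φ : TDir d n M))
      rw [chart_id_eq_chart_skewP U₀ hΦs]
      exact isUnitaryCfg_chart M hU₀u _
    have hchP : IsPeriodicCfg (ch Φ) ((N * L ^ (k + 1) : ℕ) : ℤ) := by
      rw [ePM]
      exact isPeriodicCfg_chart (ContinuousLinearMap.id ℝ (Matrix n n ℂ)) M hU₀PM _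
    have hmem : ch Φ ∈ sfClass d L N ε (k + 1) := ⟨hchu, hchP, hΦx⟩
    refine ⟨hmem, ?_⟩
    have hchPt : IsPeriodicCfg (ch Φ) ((tower L N (k + 1) : ℕ) : ℤ) := by
      rw [natCast_tower_succ, ← eP]; exact hchP
    obtain ⟨hXu, -, -⟩ := cavgIter_unitary_small hL k hchu hx hls hΦx
    have hXP : IsPeriodicCfg (cavgIter L (k + 1) (ch Φ)) (N : ℤ) := isPeriodicCfg_cavgIter L N (k + 1) hchPt
    have hQ' : skewPR N (relLog N (cavgIter L (k + 1) U₀) (cavgIter L (k + 1) (ch Φ))) = skewPR N (relLog N D₀ D) := hgΦ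
    rw [hcD] at hQ'
    have heq : cavgIter L (k + 1) (ch Φ) = D := eq_of_skewPR_relLog_eq hXP hDP hD₀u hXu hDu hΦnear hDnear hQ'
    rw [← cavgIter_eq_avgIter]
    exact heq
  · -- the action along the chart is Lipschitz on `t`
    have h := hLip.dist_le_mul Φ hΦt 0 h0t
    rw [Real.dist_eq, dist_zero_right] at h
    have hch0' : fineAction (ch 0) W = fineAction U₀ W := by rw [hch0]
    calc |fineAction (ch Φ) W - fineAction U₀ W| = |fineAction (ch Φ) W - fineAction (ch 0) W| := by rw [hch0']
      _ ≤ K * ‖Φ‖ := h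
      _ ≤ K * ρ := mul_le_mul_of_nonneg_left hΦρ K.2
      _ = K / κ * ‖y‖ := by rw [hρ]; field_simp

end

end Summit.QuantumFields.BalabanUV.T4Continuum.NE7AdmissibleFibreQuantitative
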